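import Literature.AlgebraicGeometry.Surfaces.K3RealMultiplicationCycleInduced
import Literature.AlgebraicGeometry.Surfaces.K3Marking
import HarnessLib

/-!
# The maximal √2 real-multiplication family of K3 surfaces at Picard number 10: the cycle on an open
# period set (van Geemen–Schütt 2025, Thm. 1.2 (2) / Prop. 6.2 / §6.4 / Rem. 6.5)

Family `hodge`, layer `Literature/AlgebraicGeometry/Surfaces`. Companion of
`K3RealMultiplicationCycleInduced` (EXISTENCE of one very general member,
`VanGeemenSchuett2025_rmK3_cycleInduced_sqrt2`) and of `K3RealMultiplicationZeta11OpenFamily` /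
`K3RealMultiplicationZeta9OpenFamily` (the ζ₁₁ and ζ₉ families as open-period-set inputs). Here the
`√2` family of Thm. 1.2 (2) — Picard number `10`, real multiplication by `ℚ(√2)` induced by a rational
SELF-MAP of degree `2`, FOUR moduli, a MAXIMAL family (Rem. 6.5) — is typed as what it delivers to a
consumer that descends along rational Hodge isometries: a rational, `k3Form`-self-adjoint model
endomorphism `θ ∈ M₂₂(ℚ)` of the K3 lattice (the marking transport of the cycle-induced endomorphism
of a very general member) together with an OPEN subset of the Hodge locus of `θ` at the eigenvalue `√2`
at every period point of which a marked member carries an algebraic cycle inducing `θ` (the «∃-form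
open-set input» of the route `HodgeConjecture/MarkmanPartnerTransport`, crux `PicardThreeK3Squares`,
theorem `RMTypeOrbit.hodgeConjectureFor_square_of_exists_on_open_at_of_isK3Surface`).

## Source (held text `paper:arxiv-2310.05196` = [GeemenSchutt2023], Forum Math. Sigma 13 (2025) e2;
## read 2026-08-28)

* Thm. 1.2: "(2) The 4-dimensional family of elliptic K3 surfaces in Proposition 6.2 has `ρ = 10` and
  RM by `ℚ(√2)`." Prop. 6.2: "Let `α, β ∈ ℂ[x]` with `deg(β) ≤ 3`. Then, … if `deg(α) ≤ 1`, the
  4-dimensional family of elliptic K3 surfaces `y² = x(x² + 2tα(t²)x + ½t²α(t²)² + tβ(t²))` has RM by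
  `ℚ(√2)` and very generally the Picard rank is `ρ = 10`." Rem. 6.3: "The K3 surfaces in Proposition
  6.2 admit rational self-maps of degree `2`, as we will see in the proof." §6.4 (proof): the
  fibrewise `2`-isogeny `ψ : X → X'` (quotient by the `2`-torsion section `(0,0)`, §6.1) composed with
  the isomorphism `φ' : X' ≅ X`, `(u,v,t) ↦ (2x, 2√2y, -t)`, is "the degree `2` self-map `φ' ∘ ψ` of
  `X`" and "`ℚ(√2) ⊂ End_Hod(T_X)` by inspection of the degree `2` self-map `φ' ∘ ψ` of `X` and its
  induced action on `ω`" ("Since the isogeny `ψ` preserves the regular 2-forms, `(φ ∘ ψ)^*` acts on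
  `ω = dx ∧ dt/y` as multiplication by" the square root); "the stated moduli dimensions … amount to a
  simple parameter count, compared against the 2 degrees of freedom left by scaling …"; "generally …
  6 fibres of Kodaira type `I₂` and two fibres of type `III` in the RM case of set-up (2), so …
  `NS(X) ⊃ U ⊕ A₁⁸` of rank 10 at least. But then, taking into account the moduli dimensions,
  `End_Hod(T_X)` can be at most quadratic by (eq:CM-dim), (eq:RM-dim). Therefore we obtain very
  generally `ρ = 10` and … RM by `ℚ(√2)`." **Rem. 6.5**: "We emphasize that with the given Picard
  number (or lattice polarization), Proposition 6.2 exhibits maximal dimensional families of K3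
  surfaces with RM or CM, again by (eq:CM-dim), (eq:RM-dim)." §2.6 (eq:RM-dim): "The deformation space
  of K3 surfaces with given `F`-action on `T_{X,ℚ}` has dimension `l - 2 = dim_ℝ T_ε - 2 =
  rank(T_X)/[F:ℚ] - 2`" (here `12/2 - 2 = 4`); §2.1/§2.4 (after Zarhin): `End_Hod(T_{X,ℚ})` is a
  field `F`, embedded in `ℂ` by its action on `H^{2,0}`, and for `F` totally real every element is
  self-adjoint for the intersection form.

## Lean rendering (D-0014 named fact; PURE EXISTENCE, as printed)

The tree has no Weierstrass models or rational self-maps of K3 surfaces, so the members cannot be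
named; what CAN be carried is the statement on the period side, for the model lattice
`Λ = (K3Index → ℤ, k3Gram)`. There is no cyclotomic CM anchor here (the real multiplication comes from
a self-map, not from an automorphism of a Galois cover), so the model endomorphism is not a polynomial
in a lattice isometry; the fact is stated in `∃`-form, exactly as delivered by the source:
THE DATUM. Take a very general member `X₁` of the family of Prop. 6.2 (2): a projective elliptic K3
surface with `ρ(X₁) = 10`, `End_Hod(T_{X₁,ℚ}) = ℚ(√2) = ℚ[e]`, `e := (φ' ∘ ψ)^*|_{T}` (the action of
the closure `Γ ⊂ X₁ × X₁` of the graph of the degree-`2` rational self-map; `ε(e) = ±√2`, the scalar by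
which it acts on `ω`; replacing `Γ` by `-Γ` if necessary, `ε(e) = √2 > 0`; `e² = 2` on `T` and `e`
is self-adjoint, by the injectivity of `ε` on the field `End_Hod(T_{X₁,ℚ})`, Huybrechts Ch. 3
Cor. 3.6, and `ε(e) ∈ ℝ`). Let `(η₁, p₁, x₁)` be a marking of `X₁` (tree fact
`Huybrechts_K3_marking_exists`) and put `t₁ := e ∘ π_T` (`π_T` the cup-orthogonal projector onto
`T(X₁)_ℚ = NS(X₁)_ℚ^⊥`, a rational self-adjoint idempotent commuting with `e`) and
`θ := η₁ ∘ t₁ ∘ η₁⁻¹`: a RATIONAL matrix (`t₁` is a rational endomorphism of `H²(X₁, ℚ)`, `η₁` is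
integral), `k3Form`-self-adjoint, with `ker θ_ℂ = η₁(NS(X₁) ⊗ ℂ)` of dimension `10`, `θ_ℂ³ = 2θ_ℂ`
(`e² = 2`), and `θ_ℂ x₁ = √2 x₁`, `(x₁.x₁) = 0 < (x̄₁.x₁)`.
THE OPEN SET. Along the family (parameters `(α, β)` near those of `X₁`; markings `η` transported from
`η₁`; `NS_ℚ = (U ⊕ A₁⁸)_ℚ` at the very general member) the class of the cycle
`Z = Γ ∘ (Δ - Σᵢ Dᵢ × Dᵢ^∨)` (`Dᵢ` a basis of `NS_ℚ`, `Dᵢ^∨` the dual basis; composition of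
correspondences, Fulton Prop. 16.1.1) is algebraic on every member (the self-map `φ' ∘ ψ` exists on
every member by construction, §6.4), flat (an algebraic family of cycles), and equal to `η⁻¹ ∘ θ_ℂ ∘ η`
at the very general members (flat rational classes are constant in the transported marking).
"Maximal dimensional family" (Rem. 6.5; Thm. 1.2 (2): `4 = l - 2` moduli) = the marked period image
`Ω` of the family is open in the `4`-dimensional Hodge locus
`D_{θ,√2} = {y : θ_ℂ y = √2 y, (y.y) = 0, (ȳ.y) > 0}` (this reading of «4-dimensional family» — `4`
EFFECTIVE moduli, "a simple parameter count, compared against the 2 degrees of freedom left by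
scaling" — is the paper's, §2.6/§6.4; it is the same reading as in the ζ₁₁ and ζ₉ companions); the open
set of the statement is any open `U ⊂ Λ_ℂ` with `U ∩ D_{θ,√2} ⊆ ℂ^× · Ω`, `U ∩ D_{θ,√2} ≠ ∅`, and at each
of its period points the marked member with that period line carries the cycle. The cycle clause is
quantified only over `θ`-GENERIC period points (every rational vector orthogonal to `y` is killed by
`θ`, i.e. `NS_ℚ = η⁻¹ ker θ` has rank `10`) — weaker than what the argument gives — because that is the
consumer's binder (`CycleEx[θ, √2, U]` of `…RMTypeOpenSingleEigenvalue`, VERBATIM with `thetaC θ`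
unfolded to `Matrix.toLin' (θ.map (algebraMap ℚ ℂ))`, and the route's `MarkedK3` binder expanded
verbatim).

NOT CLAIMED: any uniqueness of the rational real-multiplication type `θ` among K3 surfaces with
`ρ = 10` and `End_Hod T ∋ √2` (there are many rational types with these invariants; the fact exhibits
ONE, that of the van Geemen–Schütt family); nothing about the CM family of Prop. 6.2 (1) or the `√3`
family of Prop. 7.2 (which has `3 < l - 2 = 4` moduli and is not maximal). TODO(general form): once
elliptic K3 surfaces with Weierstrass models and rational self-maps are in the tree, state Prop. 6.2 (2)
+ §6.4 for every member and derive this fact from it.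

## References

* [GeemenSchutt2023] B. van Geemen, M. Schütt, On families of K3 surfaces with real multiplication,
  Forum Math. Sigma 13 (2025) e2, arXiv:2310.05196: Thm. 1.2 (2), §2.1, §2.4–2.6, §3.3–3.4, §6.1,
  Prop. 6.2, Rem. 6.3, §6.4, Rem. 6.5.
* [Huybrechts2016K3] D. Huybrechts, Lectures on K3 Surfaces, CUP 2016: Ch. 1 Prop. 3.5, Ch. 3
  Cor. 3.6 and Thm. 3.7 (Zarhin), Ch. 6 Prop. 1.2.
* [Fulton1998] W. Fulton, Intersection Theory, 2nd ed., §16.1 Prop. 16.1.1.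
-/

noncomputable section

open CategoryTheory MonoidalCategory Polynomial
open Literature.AlgebraicTopology.SingularHomology
open Literature.AlgebraicGeometry.HodgeTheory

namespace Literature.AlgebraicGeometry.Surfaces

/-- **van Geemen–Schütt, Thm. 1.2 (2) with Prop. 6.2, §6.4 and Rem. 6.5 (the maximal `√2`
real-multiplication family at Picard number `10`, four moduli): the model endomorphism `√2` is induced
by an algebraic cycle at every period point of an open subset of its Hodge locus.** THERE EXIST a
rational matrix `θ ∈ M₂₂(ℚ)` — the marking transport `η₁ ∘ ((φ' ∘ ψ)^* ∘ π_T) ∘ η₁⁻¹` of the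
cycle-induced real-multiplication endomorphism of a very general member
`X₁ : y² = x(x² + 2tα(t²)x + ½t²α(t²)² + tβ(t²))` (`deg α ≤ 1`, `deg β ≤ 3`; `φ' ∘ ψ` its degree-`2`
rational self-map, acting on `ω` by `√2`; `π_T` the projector onto `T(X₁)_ℚ`) — which is
`k3Form`-self-adjoint, whose kernel `ker θ_ℂ = η₁ NS(X₁)_ℂ` has dimension `10` (Picard number `10`),
with `θ_ℂ³ = 2θ_ℂ` (`θ² = 2` on `T`), AND an open `U ⊂ Λ_ℂ` meeting the Hodge locus
`D_{θ,√2} = {y : θ_ℂ y = √2 y, (y.y) = 0, (ȳ.y) > 0}` such that every `θ`-generic period point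
`y ∈ U ∩ D_{θ,√2}` (every rational vector orthogonal to `y` is killed by `θ`) is the period of a marked
projective K3 surface `(S', η', p')` (the route's `MarkedK3` clauses) carrying an algebraic class
`γ' ∈ algebraicClasses (S' ⊗ S') 2` whose correspondence `[γ']_* = fst_* (snd^*(–) ∪ γ')` (complex
orientations) is EXACTLY `η'⁻¹ ∘ θ_ℂ ∘ η'` — the member of the family with that period (Rem. 6.5: a
maximal family, `4 = l - 2` moduli, so the marked period image is open in the `4`-dimensional Hodge
locus) and its cycle `Γ_{φ' ∘ ψ} ∘ (Δ - Σ Dᵢ × Dᵢ^∨)` (§6.4: "`ℚ(√2) ⊂ End_Hod(T_X)` by inspection of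
the degree `2` self-map `φ' ∘ ψ` of `X` and its induced action on `ω`"; flat in the transported
marking and equal to `θ` there, see the module docstring). VERBATIM the input
`∃ U, IsOpen U ∧ (∃ y₁ ∈ U ∩ D_{θ,√2}) ∧ CycleEx[θ, √2, U]` of the consumer (T‴)
`…Theorems.MarkmanPartnerTransport.RMTypeOrbit.…_square_of_exists_on_open_at_of_isK3Surface` of the
Hodge summit. Pure existence; no uniqueness of the type is asserted.
[cite: GeemenSchutt2023, Thm. 1.2 (2), Prop. 6.2, Rem. 6.3, §6.4, Rem. 6.5, §2.6]
[cite: Huybrechts2016K3, Ch. 1 Prop. 3.5, Ch. 3 Cor. 3.6, Ch. 6 Prop. 1.2]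
[cite: Fulton1998, §16.1 Prop. 16.1.1] -/
def VanGeemenSchuett2025_sqrt2_cycleOnOpenPeriodSet : Prop :=
  ∃ θ : Matrix K3Index K3Index ℚ,
    -- `θ` is `k3Form`-self-adjoint (real multiplication: `End_Hod T` totally real)
    (∀ a b : K3Index → ℂ, k3Form (Matrix.toLin' (θ.map (algebraMap ℚ ℂ)) a) b =
      k3Form a (Matrix.toLin' (θ.map (algebraMap ℚ ℂ)) b)) ∧
    -- `ker θ_ℂ = η₁ NS(X₁)_ℂ` has dimension `10`: Picard number `10`
    Module.finrank ℂ (LinearMap.ker (Matrix.toLin' (θ.map (algebraMap ℚ ℂ)))) = 10 ∧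
    -- `θ² = 2` on `T = NS^⊥`: `θ³ = 2θ`
    Matrix.toLin' (θ.map (algebraMap ℚ ℂ)) ^ 3 = (2 : ℂ) • Matrix.toLin' (θ.map (algebraMap ℚ ℂ)) ∧
    ∃ U : Set (K3Index → ℂ), IsOpen U ∧
      (∃ y₁ ∈ U, Matrix.toLin' (θ.map (algebraMap ℚ ℂ)) y₁ = ((Real.sqrt 2 : ℝ) : ℂ) • y₁ ∧
        k3Form y₁ y₁ = 0 ∧ 0 < (k3Form (star y₁) y₁).re) ∧
      ∀ y : K3Index → ℂ, y ∈ U →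
        Matrix.toLin' (θ.map (algebraMap ℚ ℂ)) y = ((Real.sqrt 2 : ℝ) : ℂ) • y →
        k3Form y y = 0 → 0 < (k3Form (star y) y).re →
        (∀ v : K3Index → ℚ, k3Form (fun i => (v i : ℂ)) y = 0 → Matrix.mulVec θ v = 0) →
        ∃ (S' : Motives.SchemeOver ℂ) (hS' : IsK3Surface S')
          (η' : complexBetti S' (2 * 1) ≃ₗ[ℂ] (K3Index → ℂ)) (p' : complexBetti S' (2 * 2)),
          (p' ≠ 0 ∧ (IsIntegralClass p' ∧
            (∀ q : complexBetti S' (2 * 2), IsIntegralClass q → ∃ n : ℤ, q = n • p') ∧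
            (∀ c : complexBetti S' (2 * 1),
              IsIntegralClass c ↔ ∃ v : K3Index → ℤ, η' c = fun i => (v i : ℂ)) ∧
            (∀ a b : complexBetti S' (2 * 1),
              cupProduct (rfl : 2 * 1 + 2 * 1 = 2 * 2) a b = k3Form (η' a) (η' b) • p') ∧
            IsOfHodgeType 2 S' (2 * 1) 2 0 (LinearEquiv.symm η' y) ∧
            (∀ τ : complexBetti S' (2 * 1), IsOfHodgeType 2 S' (2 * 1) 2 0 τ →
              ∃ t : ℂ, τ = t • LinearEquiv.symm η' y)) ∧
            (k3Form y y = 0 ∧ 0 < (k3Form (star y) y).re ∧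
              ∃ u : K3Index → ℤ, k3Form (fun i => (u i : ℂ)) y = 0 ∧
                0 < ∑ i, ∑ j, u i * k3Gram i j * u j)) ∧
          ∃ γ' ∈ algebraicClasses (S' ⊗ S') 2, ∀ z : complexBetti S' (2 * 1),
            (η'.symm.toLinearMap ∘ₗ (Matrix.toLin' (θ.map (algebraMap ℚ ℂ)) ∘ₗ η'.toLinearMap)) z =
              complexGysin complexOrientationFamily
                (Motives.IsSmoothProjective.tensor_holds hS'.isSmoothProjective hS'.isSmoothProjective)
                hS'.isSmoothProjective (SemiCartesianMonoidalCategory.fst S' S')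
                (rfl : 2 * 1 + 2 * 2 + 2 * 2 = 2 * 1 + 2 * (2 + 2))
                (cupProduct (rfl : 2 * 1 + 2 * 2 = 2 * 1 + 2 * 2)
                  (complexBetti.map (SemiCartesianMonoidalCategory.snd S' S') (2 * 1) z) γ')

end Literature.AlgebraicGeometry.Surfaces

end
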